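/-
Copyright (c) 2026 the pub-hodgecm-mathlib formalisation cell (harness21).  Prover seat hodgecm-mathlib-K2E3-p17 (g8), Track B «K2-LIT» ∕ h413
(`stmt-HodgeConjecture-24833`), line `K2_E3_EllipticInputs`, leaf (nsc-S-A′), D94 sub-brick S1c (GL2-LINKED, part (c)): Jacquet ranks of subrepresentations of a
principal series of `GL₂(F)` and the uniqueness of the subrepresentation `η∘det ≤ I₂(ην^{-1∕2}, ην^{1∕2})`.  2026-09-04.
-/
import Summits.HodgeConjecture.HodgeConjecture.Theorems.K2E3GL2LinkedStructure                        -- ★∕📤 S1b (this seat): `ρ_η ↪ I₂(ην½⁻¹, ην½)`, its weight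
import Summits.HodgeConjecture.HodgeConjecture.Theorems.K2E3GL2PrincipalSeriesConstituentsJacquetNonzero -- ★ S1a (this seat): constituents of `I₂ x y` have `r_B ≠ 0`
import Summits.HodgeConjecture.HodgeConjecture.Theorems.K2E3GL3WeightOneUniqueness                      -- ★ UNIQ (K2E3-p23): `inf_eq_bot_or_eq_of_isIrreducible`, `finrank_weightSpace_add_le_of_inf_eq_bot`
import Literature.NumberTheory.Automorphic.JacquetRankStrictMono                                        -- ★ `finrank_coinvariants_eq_one_of_ne_bot_of_ne_top`, `not_bot_lt_lt_lt_top_of_finrank_coinvariants_le_two`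
import Summits.HodgeConjecture.HodgeConjecture.Theorems.K2E3DegenerateSubquotientHeredity                 -- ★ HER (this seat): `forall_mk_charTwist_eq_zero_of_surjective`, `not_isGeneric_of_surjective`
import Summits.HodgeConjecture.HodgeConjecture.Theorems.K2E3GL3PrincipalSeriesRegular                     -- ★ REG (K2E3-p23): `mul_nuHalf_inv_ne_mul_nuHalf`
import HarnessLib

/-!
# Crux `H413` — leaf (nsc-S-A′), sub-brick S1c (GL2-LINKED): JACQUET RANKS IN `I₂ x y` AND THE UNIQUENESS OF `η∘det ≤ I₂(ην^{-1∕2}, ην^{1∕2})`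

Cell `hodgecm-mathlib`, Track B; THEOREMS ONLY; count-neutral helper (`--supports stmt-HodgeConjecture-24833 --as helper`).  Currency as in ★ S1b∕G1∕PEEL (`I₂ x y`, `ρ_η`, `ν½`,
`mult₂`), the abstract Jacquet module `((parabolicTripleGL F id).restrict V).Coinvariants` of ★ `JacquetRankStrictMono`, and the leaf's `id`-labelled `r_B`.

* §1 `dim r_B(I₂ x y) = 2` in the three spellings (★ G1 `finrank_jacquet_parabolidIndGL` + kernel identifications).
* §2 **`finrank_restrict_eq_one_of_ne_bot_of_ne_top`**: every proper non-zero subrepresentation `N` of `I₂ x y` (`x, y` with open kernels) has a ONE-dimensional Jacquet module, and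
  there is no chain `⊥ < N₁ < N₂ < ⊤` (★ `JacquetRankStrictMono` fed by ★ S1a: every constituent has `r_B ≠ 0`); `id`- and `lastBlockLabel`-spellings.
* §3 **`eq_range_of_mult_swap_eq_zero`** (the linked case `I₂(a, aν)`, `a = ην½⁻¹`): a proper non-zero subrepresentation `N` WITHOUT the weight `(aν) ⊠ a` is the image of
  `ρ_η ↪ I₂(a,aν)` (★ S1b) — `N ⊓ range = ⊥` would give `mult (a ⊠ aν) ≥ 1 + 1` by ★ UNIQ's pigeonhole, against `mult_{I₂}(a ⊠ aν) = 1` (★ G1 (a), `a ≠ aν`); `range ≤ N` would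
  be a chain `⊥ < range < N < ⊤`.  Hence `N ≅ ρ_η`: `N` is non-generic and `J_ψ(N) = 0` — the input of the linked peeling step (S2) for C1′∕C1″∕C2.

HONEST LABEL: HC_CM is proved only modulo the 7 printed citations (2 remaining named inputs: hLiu418 = stmt-HodgeConjecture-24832, h413 =
stmt-HodgeConjecture-24833) until rung 0 closes; count-neutral helper.

## References
* [BernsteinZelevinsky1977] I. N. Bernstein, A. V. Zelevinsky, *Induced representations of reductive p-adic groups I*, Ann. Sci. ÉNS 10 (1977), Prop. 1.9, Thm. 2.5, Thm. 2.8, Cor. 2.13.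
* [Casselman1995] W. Casselman, *Introduction to the theory of admissible representations of p-adic reductive groups* (draft 1995), Cor. 6.3.7, Cor. 7.1.2, Prop. 7.1.3.
* [Zelevinsky1980] A. V. Zelevinsky, *Induced representations of reductive p-adic groups II*, Ann. Sci. ÉNS 13 (1980), Prop. 2.10, Ex. 3.2.
-/

set_option autoImplicit false
-- the mandated namespace repeats `HodgeConjecture.HodgeConjecture`, as in every `Theorems/*.lean` of this sub-problem
set_option linter.dupNamespace false

noncomputable section

open Module Module.End Function Matrix
open scoped MatrixGroups NNReal
open Literature.NumberTheory.Automorphic Literature.NumberTheory.Automorphic.Zelevinsky1980 ValuativeRel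
open Literature.NumberTheory.GaloisRepresentations Literature.NumberTheory.GaloisRepresentations.IsNonarchimedeanLocalField
open Literature.RepresentationTheory.FiniteGroups Literature.RepresentationTheory.Semisimple
open Summit.HodgeConjecture.HodgeConjecture.Cruxes.H413.K2E3GL2JacquetExponents (finiteDimensional_jacquet_parabolicIndGL finrank_jacquet_parabolicIndGL finrank_weightSpace_parabolicIndGL
  finrank_weightSpace_le_of_injective maxParabolicLeviChar_two_eq_iff)
open Summit.HodgeConjecture.HodgeConjecture.Cruxes.H413.K2E3GL2JacquetRelabel (finrank_weightSpace_id_eq_lastBlockLabel_two coinvariantsKer_restrictUnipotentGL_eq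
  unipotentRadicalGL_id_eq_lastBlockLabel_two)
open Summit.HodgeConjecture.HodgeConjecture.Cruxes.H413.K2E3GL2PrincipalSeriesConstituentsJacquetNonzero (forall_isConstituentOf_principalSeries_two_nontrivial_restrict)
open Summit.HodgeConjecture.HodgeConjecture.Cruxes.H413.K2E3GL3WeightOneUniqueness (inf_eq_bot_or_eq_of_isIrreducible finrank_weightSpace_add_le_of_inf_eq_bot)
open Summit.HodgeConjecture.HodgeConjecture.Cruxes.H413.K2E3GL2LinkedStructure (isIrreducible_twist_det_two finrank_weightSpace_twist_det_two_shift_id not_isGeneric_twist_det_two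
  mk_whittakerTwist_twist_det_two_eq_zero)

namespace Summit.HodgeConjecture.HodgeConjecture.Cruxes.H413.K2E3GL2LinkedJacquetRank

variable {F : Type} [Field F] [ValuativeRel F] [TopologicalSpace F] [IsNonarchimedeanLocalField F] (x y : Fˣ →* ℂˣ)

/-! ## §1 `dim r_B(I₂ x y) = 2` in three spellings -/

omit [ValuativeRel F] [TopologicalSpace F] [IsNonarchimedeanLocalField F] in
/-- The `id`-labelled and the `lastBlockLabel`-labelled Borel Jacquet modules of a representation of `GL₂(F)` are the same quotient (linear equivalence, identity on representatives).
[folklore] -/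
theorem exists_linearEquiv_jacquet_id_lastBlockLabel {X : Type*} [AddCommGroup X] [Module ℂ X] (V : Representation ℂ (GL (Fin 2) F) X) :
    ∃ Θ : (Representation.restrictUnipotentGL F (id : Fin 2 → Fin 2) V).Coinvariants ≃ₗ[ℂ] (Representation.restrictUnipotentGL F (lastBlockLabel 2) V).Coinvariants,
      ∀ z, Θ (Representation.Coinvariants.mk _ z) = Representation.Coinvariants.mk _ z :=
  ⟨Submodule.quotEquivOfEq _ _ (coinvariantsKer_restrictUnipotentGL_eq (id : Fin 2 → Fin 2) (lastBlockLabel 2) unipotentRadicalGL_id_eq_lastBlockLabel_two V),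
    fun z => Submodule.quotEquivOfEq_mk _ _ _ z⟩

/-- **`r_B(I₂ x y)` is finite-dimensional of dimension `2`** in the `id`-labelled spelling (★ G1, transported along §1's identification). [cite: BernsteinZelevinsky1977, Thm. 5.2]
[cite: Bump1997, Thm. 4.5.4] -/
theorem finrank_jacquet_id_principalSeries_two (hx : IsOpen (x.ker : Set Fˣ)) (hy : IsOpen (y.ker : Set Fˣ)) :
    FiniteDimensional ℂ (Representation.restrictUnipotentGL F (id : Fin 2 → Fin 2) (Representation.parabolicIndGL F (lastBlockLabel 2)
      ((Representation.trivial ℂ (Π a : Bool, GL {i : Fin 2 // lastBlockLabel 2 i = a} F) ℂ).twist (maxParabolicLeviChar F 2 x y)))).Coinvariants ∧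
    finrank ℂ (Representation.restrictUnipotentGL F (id : Fin 2 → Fin 2) (Representation.parabolicIndGL F (lastBlockLabel 2)
      ((Representation.trivial ℂ (Π a : Bool, GL {i : Fin 2 // lastBlockLabel 2 i = a} F) ℂ).twist (maxParabolicLeviChar F 2 x y)))).Coinvariants = 2 := by
  haveI := finiteDimensional_jacquet_parabolicIndGL x y hx hy
  obtain ⟨Θ, -⟩ := exists_linearEquiv_jacquet_id_lastBlockLabel (Representation.parabolicIndGL F (lastBlockLabel 2)
    ((Representation.trivial ℂ (Π a : Bool, GL {i : Fin 2 // lastBlockLabel 2 i = a} F) ℂ).twist (maxParabolicLeviChar F 2 x y)))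
  exact ⟨LinearEquiv.finiteDimensional Θ.symm, by rw [Θ.finrank_eq, finrank_jacquet_parabolicIndGL x y hx hy]⟩

/-- **`r_B(I₂ x y)` in the abstract spelling of ★ `JacquetRankStrictMono`** (`((parabolicTripleGL F id).restrict _).Coinvariants`, ★ `jacquetGLEquiv`): finite-dimensional of
dimension `2`. [cite: BernsteinZelevinsky1977, Thm. 5.2] -/
theorem finrank_restrict_principalSeries_two (hx : IsOpen (x.ker : Set Fˣ)) (hy : IsOpen (y.ker : Set Fˣ)) :
    FiniteDimensional ℂ ((parabolicTripleGL F (id : Fin 2 → Fin 2)).restrict (Representation.parabolicIndGL F (lastBlockLabel 2)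
      ((Representation.trivial ℂ (Π a : Bool, GL {i : Fin 2 // lastBlockLabel 2 i = a} F) ℂ).twist (maxParabolicLeviChar F 2 x y)))).Coinvariants ∧
    finrank ℂ ((parabolicTripleGL F (id : Fin 2 → Fin 2)).restrict (Representation.parabolicIndGL F (lastBlockLabel 2)
      ((Representation.trivial ℂ (Π a : Bool, GL {i : Fin 2 // lastBlockLabel 2 i = a} F) ℂ).twist (maxParabolicLeviChar F 2 x y)))).Coinvariants = 2 := by
  obtain ⟨hfd, h2⟩ := finrank_jacquet_id_principalSeries_two x y hx hy
  haveI := hfd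
  let e := (Representation.jacquetGLEquiv F (id : Fin 2 → Fin 2) (Representation.parabolicIndGL F (lastBlockLabel 2)
    ((Representation.trivial ℂ (Π a : Bool, GL {i : Fin 2 // lastBlockLabel 2 i = a} F) ℂ).twist (maxParabolicLeviChar F 2 x y)))).toLinearEquiv
  exact ⟨LinearEquiv.finiteDimensional e, by rw [← e.finrank_eq, h2]⟩

/-! ## §2 Jacquet ranks of subrepresentations of `I₂ x y` -/

/-- `I₂ x y` is smooth. [cite: BernsteinZelevinsky1977, §2.3] -/
theorem isSmooth_principalSeries_two :
    (Representation.parabolicIndGL F (lastBlockLabel 2) ((Representation.trivial ℂ (Π a : Bool, GL {i : Fin 2 // lastBlockLabel 2 i = a} F) ℂ).twist (maxParabolicLeviChar F 2 x y))).IsSmooth :=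
  Representation.isSmooth_smoothInd _ _

/-- **A PROPER NON-ZERO SUBREPRESENTATION OF `I₂ x y` HAS A ONE-DIMENSIONAL JACQUET MODULE** (abstract spelling): ★ `finrank_coinvariants_eq_one_of_ne_bot_of_ne_top` with
`dim r_B(I₂ x y) = 2` (§1) and «every constituent has `r_B ≠ 0`» (★ S1a). [cite: Casselman1995, Prop. 7.1.3, Cor. 6.3.7] [cite: BernsteinZelevinsky1977, Thm. 2.8] -/
theorem finrank_restrict_eq_one_of_ne_bot_of_ne_top (hx : IsOpen (x.ker : Set Fˣ)) (hy : IsOpen (y.ker : Set Fˣ))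
    {N : Subrepresentation (Representation.parabolicIndGL F (lastBlockLabel 2)
      ((Representation.trivial ℂ (Π a : Bool, GL {i : Fin 2 // lastBlockLabel 2 i = a} F) ℂ).twist (maxParabolicLeviChar F 2 x y)))}
    (hbot : N ≠ ⊥) (htop : N ≠ ⊤) :
    finrank ℂ ((parabolicTripleGL F (id : Fin 2 → Fin 2)).restrict N.toRepresentation).Coinvariants = 1 := by
  obtain ⟨hfd, h2⟩ := finrank_restrict_principalSeries_two x y hx hy
  haveI := hfd
  exact Representation.finrank_coinvariants_eq_one_of_ne_bot_of_ne_top (parabolicTripleGL F (id : Fin 2 → Fin 2))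
    (isLimitOfCompactOpen_parabolicTripleGL_N F (id : Fin 2 → Fin 2) monotone_id) (isSmooth_principalSeries_two x y)
    (forall_isConstituentOf_principalSeries_two_nontrivial_restrict x y) h2 hbot htop

/-- **NO CHAIN `⊥ < N₁ < N₂ < ⊤` IN `I₂ x y`** (its length is at most `2`). [cite: Casselman1995, Cor. 7.1.2] [cite: BernsteinZelevinsky1977, Thm. 2.8] -/
theorem not_bot_lt_lt_lt_top (hx : IsOpen (x.ker : Set Fˣ)) (hy : IsOpen (y.ker : Set Fˣ))
    (N₁ N₂ : Subrepresentation (Representation.parabolicIndGL F (lastBlockLabel 2)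
      ((Representation.trivial ℂ (Π a : Bool, GL {i : Fin 2 // lastBlockLabel 2 i = a} F) ℂ).twist (maxParabolicLeviChar F 2 x y)))) :
    ¬ (⊥ < N₁ ∧ N₁ < N₂ ∧ N₂ < ⊤) := by
  obtain ⟨hfd, h2⟩ := finrank_restrict_principalSeries_two x y hx hy
  haveI := hfd
  exact Representation.not_bot_lt_lt_lt_top_of_finrank_coinvariants_le_two (parabolicTripleGL F (id : Fin 2 → Fin 2))
    (isLimitOfCompactOpen_parabolicTripleGL_N F (id : Fin 2 → Fin 2) monotone_id) (isSmooth_principalSeries_two x y)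
    (forall_isConstituentOf_principalSeries_two_nontrivial_restrict x y) h2.le N₁ N₂

/-- The `id`-labelled Jacquet module of a subrepresentation of `I₂ x y` is finite-dimensional and, for a proper non-zero one, ONE-dimensional. [cite: Casselman1995, Prop. 7.1.3] -/
theorem finrank_jacquet_id_eq_one_of_ne_bot_of_ne_top (hx : IsOpen (x.ker : Set Fˣ)) (hy : IsOpen (y.ker : Set Fˣ))
    {N : Subrepresentation (Representation.parabolicIndGL F (lastBlockLabel 2)
      ((Representation.trivial ℂ (Π a : Bool, GL {i : Fin 2 // lastBlockLabel 2 i = a} F) ℂ).twist (maxParabolicLeviChar F 2 x y)))}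
    (hbot : N ≠ ⊥) (htop : N ≠ ⊤) :
    FiniteDimensional ℂ (Representation.restrictUnipotentGL F (id : Fin 2 → Fin 2) N.toRepresentation).Coinvariants ∧
    finrank ℂ (Representation.restrictUnipotentGL F (id : Fin 2 → Fin 2) N.toRepresentation).Coinvariants = 1 := by
  have h1 := finrank_restrict_eq_one_of_ne_bot_of_ne_top x y hx hy hbot htop
  let e := (Representation.jacquetGLEquiv F (id : Fin 2 → Fin 2) N.toRepresentation).toLinearEquiv
  haveI : FiniteDimensional ℂ ((parabolicTripleGL F (id : Fin 2 → Fin 2)).restrict N.toRepresentation).Coinvariants := .of_finrank_eq_succ h1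
  exact ⟨LinearEquiv.finiteDimensional e.symm, by rw [e.finrank_eq]; exact h1⟩

/-- The same in the `lastBlockLabel`-spelling of ★ G1∕PEEL. [cite: Casselman1995, Prop. 7.1.3] -/
theorem finrank_jacquet_lastBlockLabel_eq_one_of_ne_bot_of_ne_top (hx : IsOpen (x.ker : Set Fˣ)) (hy : IsOpen (y.ker : Set Fˣ))
    {N : Subrepresentation (Representation.parabolicIndGL F (lastBlockLabel 2)
      ((Representation.trivial ℂ (Π a : Bool, GL {i : Fin 2 // lastBlockLabel 2 i = a} F) ℂ).twist (maxParabolicLeviChar F 2 x y)))}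
    (hbot : N ≠ ⊥) (htop : N ≠ ⊤) :
    FiniteDimensional ℂ (Representation.restrictUnipotentGL F (lastBlockLabel 2) N.toRepresentation).Coinvariants ∧
    finrank ℂ (Representation.restrictUnipotentGL F (lastBlockLabel 2) N.toRepresentation).Coinvariants = 1 := by
  obtain ⟨hfd, h1⟩ := finrank_jacquet_id_eq_one_of_ne_bot_of_ne_top x y hx hy hbot htop
  haveI := hfd
  obtain ⟨Θ, -⟩ := exists_linearEquiv_jacquet_id_lastBlockLabel N.toRepresentation
  exact ⟨LinearEquiv.finiteDimensional Θ, by rw [← Θ.finrank_eq, h1]⟩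

/-! ## §3 The linked case: the subrepresentation with the weight `a ⊠ aν` is `η ∘ det` -/

/-- **`mult_{I₂(a,aν)}(a ⊠ aν) = 1`** in the leaf's `id`-currency (`a = ην½⁻¹ ≠ aν`; ★ G1 (a) + ★ E2-R′ relabelling). [cite: BernsteinZelevinsky1977, Thm. 5.2] [cite: Bump1997, Thm. 4.5.4] -/
theorem finrank_weightSpace_principalSeries_linked_id (η : Fˣ →* ℂˣ) (hη : IsOpen ((η.ker : Subgroup Fˣ) : Set Fˣ)) :
    finrank ℂ ↥(⨅ m, Module.End.maxGenEigenspace (Representation.normalizedJacquetGL F (id : Fin 2 → Fin 2)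
      (Representation.parabolicIndGL F (lastBlockLabel 2) ((Representation.trivial ℂ (Π a : Bool, GL {i : Fin 2 // lastBlockLabel 2 i = a} F) ℂ).twist
        (maxParabolicLeviChar F 2 (η * ((unramifiedTwist F (1 / 2) : QuasiChar F).toMonoidHom)⁻¹) (η * ((unramifiedTwist F (1 / 2) : QuasiChar F).toMonoidHom))))) m)
      (((∏ a : Fin 2, ((![η * ((unramifiedTwist F (1 / 2) : QuasiChar F).toMonoidHom)⁻¹, η * ((unramifiedTwist F (1 / 2) : QuasiChar F).toMonoidHom)] : Fin 2 → (Fˣ →* ℂˣ)) a).comp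
        (Matrix.GeneralLinearGroup.det.comp (Pi.evalMonoidHom (fun a : Fin 2 => GL {i : Fin 2 // (id : Fin 2 → Fin 2) i = a} F) a))) m : ℂˣ) : ℂ)) = 1 := by
  classical
  have ha : IsOpen (((η * ((unramifiedTwist F (1 / 2) : QuasiChar F).toMonoidHom)⁻¹).ker : Subgroup Fˣ) : Set Fˣ) :=
    K2E3GL3StandardModuleEmbedding.isOpen_ker_mul_of_isOpen hη
      (by rw [K2E3GL3StandardModuleEmbedding.ker_inv_eq_ker]; exact K2E3GL3StandardModuleEmbedding.isOpen_ker_nuHalf)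
  have hb : IsOpen (((η * ((unramifiedTwist F (1 / 2) : QuasiChar F).toMonoidHom)).ker : Subgroup Fˣ) : Set Fˣ) :=
    K2E3GL3StandardModuleEmbedding.isOpen_ker_mul_of_isOpen hη K2E3GL3StandardModuleEmbedding.isOpen_ker_nuHalf
  rw [finrank_weightSpace_id_eq_lastBlockLabel_two, finrank_weightSpace_parabolicIndGL _ _ ha hb, if_pos rfl, if_neg, add_zero]
  intro h
  exact K2E3GL3PrincipalSeriesRegular.mul_nuHalf_inv_ne_mul_nuHalf η ((maxParabolicLeviChar_two_eq_iff _ _ _ _).1 h).1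

/-- **UNIQUENESS OF `η∘det ≤ I₂(a, aν)`** (`a = ην½⁻¹`, `aν = ην½`, `η` with open kernel): let `Φ : ρ_η ↪ I₂(a,aν)` be any injective intertwining map (★ S1b) and `N` a proper
subrepresentation of `I₂(a,aν)` whose Jacquet module CARRIES the weight `a ⊠ aν` (`id`-currency `1 ≤ mult N (tch ![a, aν])`).  Then `N = range Φ`.  (`N ⊓ range Φ = ⊥` is excluded by ★
UNIQ's pigeonhole — both carry `a ⊠ aν`, of multiplicity `1` in `I₂(a,aν)`; `range Φ < N` is excluded by §2's «no 3-chain».) [cite: Zelevinsky1980, Prop. 2.10, Ex. 3.2]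
[cite: Casselman1995, Prop. 7.1.3] [cite: BernsteinZelevinsky1977, Thm. 2.8, Cor. 2.13] -/
theorem eq_range_of_le_mult (η : Fˣ →* ℂˣ) (hη : IsOpen ((η.ker : Subgroup Fˣ) : Set Fˣ))
    (Φ : ((Representation.trivial ℂ (GL (Fin 2) F) ℂ).twist (η.comp (Matrix.GeneralLinearGroup.det : GL (Fin 2) F →* Fˣ))).IntertwiningMap
      (Representation.parabolicIndGL F (lastBlockLabel 2) ((Representation.trivial ℂ (Π a : Bool, GL {i : Fin 2 // lastBlockLabel 2 i = a} F) ℂ).twist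
        (maxParabolicLeviChar F 2 (η * ((unramifiedTwist F (1 / 2) : QuasiChar F).toMonoidHom)⁻¹) (η * ((unramifiedTwist F (1 / 2) : QuasiChar F).toMonoidHom))))))
    (hΦ : Function.Injective Φ)
    (N : Subrepresentation (Representation.parabolicIndGL F (lastBlockLabel 2) ((Representation.trivial ℂ (Π a : Bool, GL {i : Fin 2 // lastBlockLabel 2 i = a} F) ℂ).twist
        (maxParabolicLeviChar F 2 (η * ((unramifiedTwist F (1 / 2) : QuasiChar F).toMonoidHom)⁻¹) (η * ((unramifiedTwist F (1 / 2) : QuasiChar F).toMonoidHom))))))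
    (htop : N ≠ ⊤)
    (hN : 1 ≤ finrank ℂ ↥(⨅ m, Module.End.maxGenEigenspace (Representation.normalizedJacquetGL F (id : Fin 2 → Fin 2) N.toRepresentation m)
      (((∏ a : Fin 2, ((![η * ((unramifiedTwist F (1 / 2) : QuasiChar F).toMonoidHom)⁻¹, η * ((unramifiedTwist F (1 / 2) : QuasiChar F).toMonoidHom)] : Fin 2 → (Fˣ →* ℂˣ)) a).comp
        (Matrix.GeneralLinearGroup.det.comp (Pi.evalMonoidHom (fun a : Fin 2 => GL {i : Fin 2 // (id : Fin 2 → Fin 2) i = a} F) a))) m : ℂˣ) : ℂ))) :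
    N = Φ.range := by
  have ha : IsOpen (((η * ((unramifiedTwist F (1 / 2) : QuasiChar F).toMonoidHom)⁻¹).ker : Subgroup Fˣ) : Set Fˣ) :=
    K2E3GL3StandardModuleEmbedding.isOpen_ker_mul_of_isOpen hη
      (by rw [K2E3GL3StandardModuleEmbedding.ker_inv_eq_ker]; exact K2E3GL3StandardModuleEmbedding.isOpen_ker_nuHalf)
  have hb : IsOpen (((η * ((unramifiedTwist F (1 / 2) : QuasiChar F).toMonoidHom)).ker : Subgroup Fˣ) : Set Fˣ) :=
    K2E3GL3StandardModuleEmbedding.isOpen_ker_mul_of_isOpen hη K2E3GL3StandardModuleEmbedding.isOpen_ker_nuHalf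
  have hIs := isSmooth_principalSeries_two (η * ((unramifiedTwist F (1 / 2) : QuasiChar F).toMonoidHom)⁻¹) (η * ((unramifiedTwist F (1 / 2) : QuasiChar F).toMonoidHom))
  obtain ⟨hfdI, -⟩ := finrank_jacquet_id_principalSeries_two (η * ((unramifiedTwist F (1 / 2) : QuasiChar F).toMonoidHom)⁻¹)
    (η * ((unramifiedTwist F (1 / 2) : QuasiChar F).toMonoidHom)) ha hb
  haveI := hfdI
  -- the image `L′ = range Φ` is irreducible, non-zero, and carries the weight `a ⊠ aν`
  haveI : ((Representation.trivial ℂ (GL (Fin 2) F) ℂ).twist (η.comp (Matrix.GeneralLinearGroup.det : GL (Fin 2) F →* Fˣ))).IsIrreducible := isIrreducible_twist_det_two η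
  let eL : ((Representation.trivial ℂ (GL (Fin 2) F) ℂ).twist (η.comp (Matrix.GeneralLinearGroup.det : GL (Fin 2) F →* Fˣ))).Equiv Φ.range.toRepresentation := Subrepresentation.equivRange Φ hΦ
  haveI hLirr : Φ.range.toRepresentation.IsIrreducible := eL.isIrreducible
  have hLbot : Φ.range ≠ ⊥ := by
    intro h
    have h1 : (Φ 1 : _) ∈ (⊥ : Subrepresentation (Representation.parabolicIndGL F (lastBlockLabel 2) ((Representation.trivial ℂ (Π a : Bool, GL {i : Fin 2 // lastBlockLabel 2 i = a} F) ℂ).twist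
        (maxParabolicLeviChar F 2 (η * ((unramifiedTwist F (1 / 2) : QuasiChar F).toMonoidHom)⁻¹) (η * ((unramifiedTwist F (1 / 2) : QuasiChar F).toMonoidHom)))))) :=
      h ▸ ⟨1, rfl⟩
    have h0 : Φ 1 = 0 := h1
    exact one_ne_zero (hΦ (h0.trans (map_zero Φ).symm))
  have hmultL : 1 ≤ finrank ℂ ↥(⨅ m, Module.End.maxGenEigenspace (Representation.normalizedJacquetGL F (id : Fin 2 → Fin 2) Φ.range.toRepresentation m)
      (((∏ a : Fin 2, ((![η * ((unramifiedTwist F (1 / 2) : QuasiChar F).toMonoidHom)⁻¹, η * ((unramifiedTwist F (1 / 2) : QuasiChar F).toMonoidHom)] : Fin 2 → (Fˣ →* ℂˣ)) a).comp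
        (Matrix.GeneralLinearGroup.det.comp (Pi.evalMonoidHom (fun a : Fin 2 => GL {i : Fin 2 // (id : Fin 2 → Fin 2) i = a} F) a))) m : ℂˣ) : ℂ)) := by
    haveI : FiniteDimensional ℂ (Representation.restrictUnipotentGL F (id : Fin 2 → Fin 2) Φ.range.toRepresentation).Coinvariants :=
      K2E3GL3JacquetMultiplicityAdditive.finiteDimensional_jacquet_subrepresentation _ monotone_id hIs Φ.range
    haveI : FiniteDimensional ℂ (Representation.restrictUnipotentGL F (id : Fin 2 → Fin 2) ((Representation.trivial ℂ (GL (Fin 2) F) ℂ).twist (η.comp (Matrix.GeneralLinearGroup.det : GL (Fin 2) F →* Fˣ)))).Coinvariants :=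
      inferInstance
    rw [← K2E3GL3JacquetMultiplicityAdditive.finrank_weightSpace_eq_of_equiv _ _ eL, finrank_weightSpace_twist_det_two_shift_id]
  -- `N ⊓ L′` is `⊥` or `L′` (irreducibility of `L′`)
  have hinf : N ⊓ Φ.range = ⊥ ∨ Φ.range ≤ N := by
    let M : Subrepresentation Φ.range.toRepresentation :=
      ⟨N.toSubmodule.comap Φ.range.toSubmodule.subtype, fun g _ hv => N.apply_mem_toSubmodule g hv⟩
    rcases IsSimpleOrder.eq_bot_or_eq_top M with hM | hM
    · refine Or.inl (le_bot_iff.1 fun v hv => ?_)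
      have hvM : (⟨v, hv.2⟩ : ↥Φ.range.toSubmodule) ∈ M := hv.1
      rw [hM] at hvM
      have h0 : (⟨v, hv.2⟩ : ↥Φ.range.toSubmodule) = 0 := hvM
      exact congrArg Subtype.val h0
    · refine Or.inr fun v hv => ?_
      have h1 : (⟨v, hv⟩ : ↥Φ.range.toSubmodule) ∈ M := by rw [hM]; exact Submodule.mem_top
      exact h1
  rcases hinf with hinf | hle
  · -- pigeonhole: `1 + 1 ≤ mult_I (a ⊠ aν) = 1`
    have hpig := finrank_weightSpace_add_le_of_inf_eq_bot _ hIs hinf (fun m => (((∏ a : Fin 2, ((![η * ((unramifiedTwist F (1 / 2) : QuasiChar F).toMonoidHom)⁻¹, η * ((unramifiedTwist F (1 / 2) : QuasiChar F).toMonoidHom)] : Fin 2 → (Fˣ →* ℂˣ)) a).comp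
        (Matrix.GeneralLinearGroup.det.comp (Pi.evalMonoidHom (fun a : Fin 2 => GL {i : Fin 2 // (id : Fin 2 → Fin 2) i = a} F) a))) m : ℂˣ) : ℂ))
    simp only [finrank_weightSpace_principalSeries_linked_id η hη] at hpig
    omega
  · -- `L′ ≤ N`: equality, or a chain `⊥ < L′ < N < ⊤`
    by_contra hNL
    exact not_bot_lt_lt_lt_top _ _ ha hb Φ.range N ⟨bot_lt_iff_ne_bot.2 hLbot, lt_of_le_of_ne hle (Ne.symm hNL), lt_top_iff_ne_top.2 htop⟩

/-- **Consequently such an `N` is equivalent to `ρ_η = η ∘ det`**, hence NON-GENERIC with `J_ψ(N) = 0` for every non-trivial `ψ`. [cite: Zelevinsky1980, Prop. 2.10, Ex. 3.2] -/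
theorem mk_whittakerTwist_eq_zero_of_le_mult (η : Fˣ →* ℂˣ) (hη : IsOpen ((η.ker : Subgroup Fˣ) : Set Fˣ))
    (Φ : ((Representation.trivial ℂ (GL (Fin 2) F) ℂ).twist (η.comp (Matrix.GeneralLinearGroup.det : GL (Fin 2) F →* Fˣ))).IntertwiningMap
      (Representation.parabolicIndGL F (lastBlockLabel 2) ((Representation.trivial ℂ (Π a : Bool, GL {i : Fin 2 // lastBlockLabel 2 i = a} F) ℂ).twist
        (maxParabolicLeviChar F 2 (η * ((unramifiedTwist F (1 / 2) : QuasiChar F).toMonoidHom)⁻¹) (η * ((unramifiedTwist F (1 / 2) : QuasiChar F).toMonoidHom))))))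
    (hΦ : Function.Injective Φ)
    (N : Subrepresentation (Representation.parabolicIndGL F (lastBlockLabel 2) ((Representation.trivial ℂ (Π a : Bool, GL {i : Fin 2 // lastBlockLabel 2 i = a} F) ℂ).twist
        (maxParabolicLeviChar F 2 (η * ((unramifiedTwist F (1 / 2) : QuasiChar F).toMonoidHom)⁻¹) (η * ((unramifiedTwist F (1 / 2) : QuasiChar F).toMonoidHom))))))
    (htop : N ≠ ⊤)
    (hN : 1 ≤ finrank ℂ ↥(⨅ m, Module.End.maxGenEigenspace (Representation.normalizedJacquetGL F (id : Fin 2 → Fin 2) N.toRepresentation m)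
      (((∏ a : Fin 2, ((![η * ((unramifiedTwist F (1 / 2) : QuasiChar F).toMonoidHom)⁻¹, η * ((unramifiedTwist F (1 / 2) : QuasiChar F).toMonoidHom)] : Fin 2 → (Fˣ →* ℂˣ)) a).comp
        (Matrix.GeneralLinearGroup.det.comp (Pi.evalMonoidHom (fun a : Fin 2 => GL {i : Fin 2 // (id : Fin 2 → Fin 2) i = a} F) a))) m : ℂˣ) : ℂ))) {ψ : AddChar F Circle} (hψ : ψ ≠ 0) :
    Nonempty (N.toRepresentation.Equiv ((Representation.trivial ℂ (GL (Fin 2) F) ℂ).twist (η.comp (Matrix.GeneralLinearGroup.det : GL (Fin 2) F →* Fˣ)))) ∧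
      ¬ IsGeneric N.toRepresentation ψ ∧ ∀ w, Representation.Coinvariants.mk (whittakerTwist N.toRepresentation ψ) w = 0 := by
  have hNe := eq_range_of_le_mult η hη Φ hΦ N htop hN
  subst hNe
  let eL : ((Representation.trivial ℂ (GL (Fin 2) F) ℂ).twist (η.comp (Matrix.GeneralLinearGroup.det : GL (Fin 2) F →* Fˣ))).Equiv Φ.range.toRepresentation := Subrepresentation.equivRange Φ hΦ
  have hsurj : Function.Surjective eL.toIntertwiningMap := eL.toLinearEquiv.surjective
  refine ⟨⟨eL.symm⟩, K2E3DegenerateSubquotientHeredity.not_isGeneric_of_surjective _ eL.toIntertwiningMap hsurj (not_isGeneric_twist_det_two η hψ), fun w => ?_⟩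
  exact K2E3DegenerateSubquotientHeredity.forall_mk_charTwist_eq_zero_of_surjective eL.toIntertwiningMap hsurj (mk_whittakerTwist_twist_det_two_eq_zero η hψ) w

end Summit.HodgeConjecture.HodgeConjecture.Cruxes.H413.K2E3GL2LinkedJacquetRank

end
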